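import Summits.HodgeConjecture.Ring2.LowDimensionHodgeOfMarkmanRowFour
import Summits.HodgeConjecture.Ring2.NonCMFivefoldsCodimTwoResidualQuartic
import Literature.AlgebraicGeometry.HodgeTheory.UnitaryTypeOneTimesCMCurveProductSpan
import Literature.AlgebraicGeometry.HodgeTheory.NoTypeIVTimesCMGrouping
import HarnessLib

/-!
# Ring 2 (cell topic `Summits/HodgeConjecture/Ring2/`; seat `lit`, gen 65, H9): `HCUpToDim 5` modulo Markman and Tankeev–Ribet — case (g) only for `End⁰(X₂)` a QUARTIC FIELD

HONEST FRAMING (cell `pub-hodge-ring2`, verbatim): research route conditional on HC_CM; not a corollary;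
Q11.4-sentence-2 already refuted in dim ≥ 3. `HC_CM` does NOT occur in this file. Markman's theorem
(`Markman2025_weilClasses_algebraic_abelianFourfold`) and Tankeev–Ribet
(`TankeevRibet1983_hodgeClasses_divisorial_powers_simplePrimeDimension`) are HYPOTHESES of the axis theorem, never
asserted. Theorems only — no definition, no named fact, no `sorry`. No case of the Hodge conjecture is claimed beyond
the unconditional rows quoted from the tree.

THE PRINT. B. Moonen, Yu. Zarhin, Math. Ann. **315** (1999), Thm. 0.2 (3) case (g) «`X₂` a simple abelian fourfold
such that there exists an embedding `k ↪ End⁰(X₂)` via which `k` acts on `T_{X₂,0}` with multiplicities `(1,3)` … Then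
the Hodge ring `B•(X)` is generated by divisor classes»; §5 (5.10) «Write `k = End⁰(E)` and `F = End⁰(Y)` … Case 2:
Suppose that `k` acts on `T_{Y,0}` with multiplicities `(1,3)`»; §1 (1.1) (Albert's types).

THIS FILE refines the axis `LowDimOfMarkman.hcUpToDim_five_iff_rowFour_caseG13_of_markman_of_tankeevRibet` (granted
the two named facts: `HCUpToDim 5 ↔ HC(row-four residual of the simple non-CM fourfolds) ∧ HC(case (g) with
multiplicities (1,3) ∪ case (e) ∩ (a1))`) by READING CASE (g) IN ALBERT'S TABLE: for the simple non-CM fourfold `F`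
with its central `φ`, `φ ≫ φ = -(M²d')`, of multiplicities `(1,3)`,
* `dim_ℚ End⁰(F) = 2` (`End⁰(F) = k`) is a THEOREM of the tree — Moonen–Zarhin Thm. 0.2 (3) for `End⁰(X₂) = k`, the
  Literature lane's `hodgeConjectureFor_of_isIsogenous_prod_cmCurve_of_unitaryTypeOne` (R29, unconditional);
* otherwise Albert at `g = 4` (the lane's `isField_or_finrank_eq_eight_of_dim_eq_four_of_not_isOfCMType_of_hom`):
  `End⁰(F)` is a quartic FIELD, or `[End⁰(F):ℚ] = 8` with centre of degree `2` — and the latter cell is EMPTY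
  (`NonCMFivefoldsCodimTwoResidualQuartic.not_quaternionCell`: a quaternion algebra over `k` forces even multiplicities).
* §1 `hcOnClass_caseG13_of_caseGQuartic` — HC on «case (g), `End⁰(F)` a quartic field» ∪ «case (e) ∩ (a1)» implies HC
  on «case (g), multiplicities (1,3)» ∪ «case (e) ∩ (a1)» (unconditionally).
* §2 **`hcUpToDim_five_iff_rowFour_caseGQuartic_of_markman_of_tankeevRibet`** — granted Markman and Tankeev–Ribet:
  `HCUpToDim 5 ↔ HC(simple non-CM fourfolds, neither Ribet type (3,1) over `k = End⁰` nor minimal quaternion type)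
  ∧ HC({`X ∼ C × F`: `C` an elliptic curve with `χ ≫ χ = -d'`, `F` a simple non-CM fourfold whose `End⁰` is a QUARTIC
  FIELD, carrying a central `φ`, `φ ≫ φ = -(M²d')`, of multiplicities `(1,3)`} ∪ {`X ∼ E × (E × T)`: case (e) ∩ (a1)})`;
  on path `caseGQuarticResidualCell_of_hodgeConjecture`.

WHAT IS NOT CLAIMED: neither residual class is closed here; nothing on which quartic fields occur; `HC_CM`, Markman,
Tankeev–Ribet never asserted.

## References
* [MoonenZarhin1999LowDim] B. Moonen, Yu. Zarhin, Math. Ann. 315 (1999) 711–733, Thm. 0.1, Thm. 0.2 (1), (3), cases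
  (e), (g), §1 (1.1), §2 (2.4), Thm. (2.7), §5 (5.10)–(5.12).
* [MumfordAV1970] D. Mumford, *Abelian Varieties* (1970), §19 Cor. 2, §21 (pp. 201–202).
* [Tankeev1983] S. G. Tankeev, *Cycles on simple abelian varieties of prime dimension*, Math. USSR-Izv. 20 (1983).
* [Deligne2000] P. Deligne, *The Hodge conjecture* (Clay problem description, 2000), §1.
* [claim: Markman2025SurveySecant, status: under-review] E. Markman, arXiv:2509.23403, Thm. 1.2.
-/

noncomputable section

open CategoryTheory CategoryTheory.Limits

namespace Summit.HodgeConjecture.Ring2.LowDimOfMarkman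

open Literature.AlgebraicGeometry.Motives (AbelianVariety)
open Literature.AlgebraicGeometry.Motives.AbelianVariety
open Literature.AlgebraicGeometry.HodgeTheory
open Literature.AlgebraicGeometry.ComplexMultiplication
open Literature.AlgebraicGeometry.Milne1999
open NumberField
open Literature.NumberTheory.Automorphic (IsQuaternionAlgebra)
open Summit.HodgeConjecture.HodgeConjecture.Ring2.ClassTargets
open Summit.HodgeConjecture.Ring2.NonCMFivefoldsCodimTwoResidualQuartic (not_quaternionCell)

/-! ### §1 Case (g): multiplicities `(1,3)` ⟸ the quartic-field sub-cell (plus theorems of the tree) -/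

/-- **Case (g) reduces to `End⁰(F)` a quartic field.** HC on the fivefolds of «case (g) with `End⁰(F)` a QUARTIC FIELD»
∪ «case (e) ∩ (a1)» implies HC on the fivefolds of «case (g) with multiplicities `(1,3)`» ∪ «case (e) ∩ (a1)»: for
`dim_ℚ End⁰(F) = 2` the tree PROVES HC (`hodgeConjectureFor_of_isIsogenous_prod_cmCurve_of_unitaryTypeOne`, Moonen–Zarhin
Thm. 0.2 (3) with `End⁰(X₂) = k`), otherwise Albert at `g = 4` leaves a quartic field or a quaternion algebra over `k`,
and the latter carries no `(1,3)` (`not_quaternionCell`). [cite: MoonenZarhin1999LowDim, Thm. 0.2 (3) case (g) and §5 (5.10)–(5.11)]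
[cite: MumfordAV1970, §21 (pp. 201–202)] -/
theorem hcOnClass_caseG13_of_caseGQuartic
    (h : HCOnClass fun A => A.dim = 5 ∧
        ((∃ (C F : AbelianVariety ℂ) (χ : C ⟶ C) (d' : ℕ) (φ : F ⟶ F) (M : ℕ), C.dim = 1 ∧ 0 < d' ∧
          χ ≫ χ = -(d' • 𝟙 C) ∧ F.IsSimple ∧ F.dim = 4 ∧ ¬ IsOfCMType F ∧
          IsField F.endAlgebra ∧ Module.finrank ℚ F.endAlgebra = 4 ∧ 0 < M ∧ φ ≫ φ = -((M * M * d') • 𝟙 F) ∧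
          AbelianVariety.endAlgebra.of F φ ∈ Subalgebra.center ℚ F.endAlgebra ∧
          (eigenMultiplicity F φ (Complex.I * (Real.sqrt (M * M * d' : ℕ) : ℂ)) = 1 ∨
            eigenMultiplicity F φ (-(Complex.I * (Real.sqrt (M * M * d' : ℕ) : ℂ))) = 1) ∧
          AbelianVariety.IsIsogenous A (C.prod F)) ∨
        (∃ E T : AbelianVariety ℂ, E.dim = 1 ∧ IsOfCMType E ∧ T.IsSimple ∧ T.dim = 3 ∧
          Module.finrank ℚ T.endAlgebra = 2 ∧ Nonempty (E.endAlgebra →+* T.endAlgebra) ∧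
          AbelianVariety.IsIsogenous A (E.prod (E.prod T))))) :
    HCOnClass fun A => A.dim = 5 ∧
        ((∃ (C F : AbelianVariety ℂ) (χ : C ⟶ C) (d' : ℕ) (φ : F ⟶ F) (M : ℕ), C.dim = 1 ∧ 0 < d' ∧
          χ ≫ χ = -(d' • 𝟙 C) ∧ F.IsSimple ∧ F.dim = 4 ∧ ¬ IsOfCMType F ∧ 0 < M ∧ φ ≫ φ = -((M * M * d') • 𝟙 F) ∧
          AbelianVariety.endAlgebra.of F φ ∈ Subalgebra.center ℚ F.endAlgebra ∧
          (eigenMultiplicity F φ (Complex.I * (Real.sqrt (M * M * d' : ℕ) : ℂ)) = 1 ∨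
            eigenMultiplicity F φ (-(Complex.I * (Real.sqrt (M * M * d' : ℕ) : ℂ))) = 1) ∧
          AbelianVariety.IsIsogenous A (C.prod F)) ∨
        (∃ E T : AbelianVariety ℂ, E.dim = 1 ∧ IsOfCMType E ∧ T.IsSimple ∧ T.dim = 3 ∧
          Module.finrank ℚ T.endAlgebra = 2 ∧ Nonempty (E.endAlgebra →+* T.endAlgebra) ∧
          AbelianVariety.IsIsogenous A (E.prod (E.prod T)))) := by
  rintro A ⟨hA5, ⟨C, F, χ, d', φ, M, hC, hd', hχ, hFs, hF4, hF, hM, hφ, hφZ, hm1, hiso⟩ | hE⟩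
  · have hpos : 0 < M * M * d' := Nat.mul_pos (Nat.mul_pos hM hM) hd'
    by_cases h2 : Module.finrank ℚ F.endAlgebra = 2
    · -- `End⁰(F) = k`: Moonen–Zarhin Thm. 0.2 (3), a theorem of the tree (R29)
      exact (hodgeConjectureFor_of_isIsogenous_prod_cmCurve_of_unitaryTypeOne (X := A) (by omega : 4 ≤ F.dim) h2 φ
        hpos hφ hm1 hC χ hd' hχ (hiso.trans (isIsogenous_prod_comm C F))).2
    · rcases isField_or_finrank_eq_eight_of_dim_eq_four_of_not_isOfCMType_of_hom hFs hF4 hF φ hpos hφ hφZ h2 with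
        ⟨hK, hK4⟩ | ⟨h8, hZ2⟩
      · exact h A ⟨hA5, Or.inl ⟨C, F, χ, d', φ, M, hC, hd', hχ, hFs, hF4, hF, hK, hK4, hM, hφ, hφZ, hm1, hiso⟩⟩
      · exact (not_quaternionCell hFs hF4 h8 hZ2 hM hd' hφ hφZ
          (eigenMultiplicity_ne_of_eq_one_of_dim_eq_four hF4 φ hpos hφ hm1)).elim
  · exact h A ⟨hA5, Or.inr hE⟩

/-! ### §2 The axis with case (g) in Albert's terms -/

/-- **`HCUpToDim 5` MODULO MARKMAN AND TANKEEV–RIBET, CASE (g) ONLY FOR A QUARTIC FIELD.** Granted the tree's named facts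
`Markman2025_weilClasses_algebraic_abelianFourfold` and `TankeevRibet1983_hodgeClasses_divisorial_powers_simplePrimeDimension`
(hypotheses), the Hodge conjecture for all complex abelian varieties of dimension `≤ 5` is EQUIVALENT to the Hodge
conjecture on (α) the simple fourfolds not of CM type, neither of Ribet type `(3,1)` over `k = End⁰` nor of minimal
quaternion type [the rest of Moonen–Zarhin 1995], together with (β) the fivefolds `X ∼ X₁ × X₂`, `X₁` an elliptic curve
with `χ ≫ χ = -d'`, `X₂` a simple fourfold not of CM type whose endomorphism algebra is a QUARTIC FIELD (Type IV(2,1)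
`⊋ k`), with a central `φ`, `φ ≫ φ = -(M²d')`, acting on `H^{1,0}(X₂)` with multiplicities `(1,3)` [Thm. 0.2 (3) with
`End⁰(X₂) ⊋ k`] and (γ) the fivefolds `X ∼ X₁² × X₂`, `X₂` a simple threefold with `dim_ℚ End⁰(X₂) = 2`,
`End⁰(X₁) ↪ End⁰(X₂)` [case (e) ∩ (a1), Thm. 0.2 (1)]. [cite: MoonenZarhin1999LowDim, Thm. 0.1, Thm. 0.2 (1), (3), §1 (1.1), §2 Thm. (2.7) and §5 (5.10)]
[cite: Tankeev1983, main theorem] [cite: MumfordAV1970, §21 (pp. 201–202)] [claim: Markman2025SurveySecant, status: under-review] -/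
theorem hcUpToDim_five_iff_rowFour_caseGQuartic_of_markman_of_tankeevRibet
    (hMark : Markman2025_weilClasses_algebraic_abelianFourfold)
    (hTR : TankeevRibet1983_hodgeClasses_divisorial_powers_simplePrimeDimension) :
    HCUpToDim 5 ↔ (HCOnClass fun A => A.dim = 4 ∧ A.IsSimple ∧ ¬ IsOfCMType A ∧
      (¬ ∃ (φ : A ⟶ A) (d : ℕ), 0 < d ∧ φ ≫ φ = -(d • 𝟙 A) ∧ Module.finrank ℚ A.endAlgebra = 2 ∧
        (eigenMultiplicity A φ (Complex.I * (Real.sqrt d : ℂ)) = 1 ∨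
          eigenMultiplicity A φ (-(Complex.I * (Real.sqrt d : ℂ))) = 1)) ∧
      (¬ ∃ (K : Type) (_ : Field K) (_ : NumberField K) (_ : IsTotallyReal K) (_ : Algebra K A.endAlgebra)
        (_ : IsScalarTower ℚ K A.endAlgebra) (_ : IsQuaternionAlgebra K A.endAlgebra), A.dim = 2 * Module.finrank ℚ K)) ∧
      HCOnClass fun A => A.dim = 5 ∧
        ((∃ (C F : AbelianVariety ℂ) (χ : C ⟶ C) (d' : ℕ) (φ : F ⟶ F) (M : ℕ), C.dim = 1 ∧ 0 < d' ∧
          χ ≫ χ = -(d' • 𝟙 C) ∧ F.IsSimple ∧ F.dim = 4 ∧ ¬ IsOfCMType F ∧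
          IsField F.endAlgebra ∧ Module.finrank ℚ F.endAlgebra = 4 ∧ 0 < M ∧ φ ≫ φ = -((M * M * d') • 𝟙 F) ∧
          AbelianVariety.endAlgebra.of F φ ∈ Subalgebra.center ℚ F.endAlgebra ∧
          (eigenMultiplicity F φ (Complex.I * (Real.sqrt (M * M * d' : ℕ) : ℂ)) = 1 ∨
            eigenMultiplicity F φ (-(Complex.I * (Real.sqrt (M * M * d' : ℕ) : ℂ))) = 1) ∧
          AbelianVariety.IsIsogenous A (C.prod F)) ∨
        (∃ E T : AbelianVariety ℂ, E.dim = 1 ∧ IsOfCMType E ∧ T.IsSimple ∧ T.dim = 3 ∧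
          Module.finrank ℚ T.endAlgebra = 2 ∧ Nonempty (E.endAlgebra →+* T.endAlgebra) ∧
          AbelianVariety.IsIsogenous A (E.prod (E.prod T)))) := by
  rw [hcUpToDim_five_iff_rowFour_caseG13_of_markman_of_tankeevRibet hMark hTR]
  refine and_congr_right fun _ => ⟨fun h => hcOnClass_mono (fun A hA => ⟨hA.1, ?_⟩) h, hcOnClass_caseG13_of_caseGQuartic⟩
  rcases hA.2 with ⟨C, F, χ, d', φ, M, hC, hd', hχ, hFs, hF4, hF, -, -, hM, hφ, hφZ, hm1, hiso⟩ | hE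
  · exact Or.inl ⟨C, F, χ, d', φ, M, hC, hd', hχ, hFs, hF4, hF, hM, hφ, hφZ, hm1, hiso⟩
  · exact Or.inr hE

/-- **On path**: every cell of this file is a case of the summit. [cite: Deligne2000, §1] -/
theorem caseGQuarticResidualCell_of_hodgeConjecture (h : _root_.HodgeConjecture) :
    HCOnClass fun A => A.dim = 5 ∧
        ((∃ (C F : AbelianVariety ℂ) (χ : C ⟶ C) (d' : ℕ) (φ : F ⟶ F) (M : ℕ), C.dim = 1 ∧ 0 < d' ∧
          χ ≫ χ = -(d' • 𝟙 C) ∧ F.IsSimple ∧ F.dim = 4 ∧ ¬ IsOfCMType F ∧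
          IsField F.endAlgebra ∧ Module.finrank ℚ F.endAlgebra = 4 ∧ 0 < M ∧ φ ≫ φ = -((M * M * d') • 𝟙 F) ∧
          AbelianVariety.endAlgebra.of F φ ∈ Subalgebra.center ℚ F.endAlgebra ∧
          (eigenMultiplicity F φ (Complex.I * (Real.sqrt (M * M * d' : ℕ) : ℂ)) = 1 ∨
            eigenMultiplicity F φ (-(Complex.I * (Real.sqrt (M * M * d' : ℕ) : ℂ))) = 1) ∧
          AbelianVariety.IsIsogenous A (C.prod F)) ∨
        (∃ E T : AbelianVariety ℂ, E.dim = 1 ∧ IsOfCMType E ∧ T.IsSimple ∧ T.dim = 3 ∧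
          Module.finrank ℚ T.endAlgebra = 2 ∧ Nonempty (E.endAlgebra →+* T.endAlgebra) ∧
          AbelianVariety.IsIsogenous A (E.prod (E.prod T)))) :=
  hcOnClass_of_hodgeConjecture _ h

end Summit.HodgeConjecture.Ring2.LowDimOfMarkman

end
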